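import Literature.Geometry.Riemannian.PinchingEstimatesTwoLargest
import Mathlib.Analysis.Matrix.Order
import Mathlib.LinearAlgebra.CrossProduct
import HarnessLib

/-!
# Hamilton 1986: `M ≥ 0` (and `M ≥ m`) is preserved by the curvature ODE `M' = M² + M^#`
(topic `Geometry/Riemannian`)

A step of the decomposition of the named fact
`Literature.Geometry.Riemannian.hamilton_positiveCurvatureOperator_classification_four`
(`HamiltonPCOClassification.lean`; Hamilton 1986, Thm. 1.1: a compact four-manifold with positive
curvature operator is diffeomorphic to `S⁴` or `RP⁴`). Hamilton's proof runs the (normalised)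
Ricci flow and shows that the curvature operator `M = (A B; ᵗB C)` (block decomposition
`Λ² = Λ²₊ ⊕ Λ²₋`, §6) stays in a pinching set (Thm. 7.1); the proof of Thm. 7.1 opens (p. 171)
with "Note first that `M ≥ 0` is preserved, so we can assume `0 ≤ a₁ ≤ a₂ ≤ a₃`, …". This file
PROVES that first step at the level of the ODE `M' = M² + M^#` in block form
(`HamiltonODE.field`, `HamiltonCurvatureODE.lean`), together with its companion `M ≥ m`
(`m ≥ 0`), and reduces the corresponding statement for the Ricci flow on a closed 4-manifold to
the maximum principle for systems (the named fact `hamilton_maximumPrinciple_curvatureODE`),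
exactly as the paper does (§5, 5.2, p. 164: "Then it will remain in `X` by the argument in §4").

## Contents (all proved; no named facts)

* `HamiltonODE.quad p v` — the quadratic form `M(v, v) = ᵗx A x + 2 ᵗx B y + ᵗy C y` of the
  block triple `p = (A, B, C)` on `v = (x, y) ∈ Λ²₊ ⊕ Λ²₋ = ℝ³ × ℝ³`; `HamiltonODE.sharpQuad p v`
  — the form `ᵗx A^# x + 2 ᵗx B^# y + ᵗy C^# y` of Hamilton's `M^# = 2 (A^# B^#; · C^#)` (1986,
  p. 157), halved; `HamiltonODE.OperatorGE p m` — **`M ≥ m`**, i.e. `M(v, v) ≥ m |v|²` for all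
  `v` (`m = 0`: nonnegative curvature operator, in the block coordinates).
* `HamiltonODE.two_smul_sharp_gram`, `HamiltonODE.two_mul_sharpQuad_gram` — **the Gram identity
  for `M^#`**: if `A = Σ pₖ ᵗpₖ`, `B = Σ pₖ ᵗqₖ`, `C = Σ qₖ ᵗqₖ` then
  `2 (ᵗx A^# x + 2 ᵗx B^# y + ᵗy C^# y) = Σₖ Σₗ (x · pₖ × pₗ + y · qₖ × qₗ)²`, the block form
  of the Lie-algebraic
  identity `M^#(v, v) = ½ Σ λₖ λₗ ⟨[ωₖ, ωₗ], v⟩²` on `so(4) = so(3) ⊕ so(3)` (via the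
  polarisation `polarSharp` of `X ↦ X^#` and `β(p ᵗq, p' ᵗq') = (p × p') ᵗ(q × q')`);
* `HamiltonODE.sharpQuad_nonneg_of_quad_nonneg` — **`M ≥ 0 ⇒ M^# ≥ 0`** in block form
  (`M = ᵗN N` by the square root of a positive semidefinite matrix, `CFC.sqrt`);
* `HamiltonODE.quad_field` — along the ODE, `M'(v, v) = |Mv|² + M^#(v, v)` for `A`, `C`
  symmetric;
* `HamiltonODE.isInvariantRel_operatorGE`, `HamiltonODE.isInvariant_isSymm_operatorGE` —
  **`{M ≥ m}` is forward invariant** under `HamiltonODE.field` relative to (resp. intersected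
  with) the invariant phase space `{A, C symmetric}` (`isInvariant_isSymm`,
  `PinchingEstimatesConstraints.lean`), for every `m ≥ 0`; with closedness, convexity and
  `B ↦ -B`-symmetry of `{M ≥ m}` (`isClosed_operatorGE`, `convex_operatorGE`,
  `OperatorGE.reflectB`);
* `ricciFlow_preserves_operatorGE_of_maximumPrinciple` — the Ricci-flow statement from
  `hamilton_maximumPrinciple_curvatureODE`.

## The proof of invariance

`λ(t) = min_{|v| = 1} M_t(v, v)` is a minimum over the compact unit sphere of `ℝ⁶`, so Hamilton's
Lipschitz calculus applies in the barrier form `HamiltonODE.minOverSet_nonneg_of_deriv`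
(`HamiltonODEMinBarrier.lean`; Hamilton 1986, Lemmas 3.1, 3.5, Cor. 3.3): only the sign of
`M'(v, v) = |Mv|² + M^#(v, v)` at a minimiser `v` is needed. If the minimum is positive, `M ≥ 0`
and `M^#(v, v) ≥ 0`. For `m = 0` the barrier lemma also asks for minimisers with slightly
negative value `λ`; there `M = M₀ + λ·1` with `M₀ ≥ 0` and
`M^#(v, v) = M₀^#(v, v) + λ · traceForm M₀ (v) + λ²` (`sharpQuad_add_smul_idBlocks`, from
`(A + t)^# = A^# + t (tr A · 1 - ᵗA) + t²` for `3 × 3` matrices) is bounded below by `C λ` with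
`C` uniform along the (continuous) solution — Hamilton's Cor. 3.3.

## Design notes

* The phase-space constraint `A, C` symmetric is necessary for `ᵗv M² v = |Mv|²` and is how the
  tree's chain of pinching estimates is organised (`PinchingEstimatesODE.lean`); the trace
  constraint `tr A = tr C` is not needed here.
* `OperatorGE` is stated in the coordinates `(x, y)` of the block decomposition, as are all sets
  of the chain fed to `hamilton_maximumPrinciple_curvatureODE`; the identification with
  `HasPositiveCurvatureOperatorWith` (`CurvatureOperator.lean`, 2-vectors `Σ Xₐ ∧ Yₐ`) is a change
  of basis in `Λ²` not carried out in this file.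
* The sign convention of the `B^#` term (see `HamiltonCurvatureODE.lean`) is immaterial:
  `{M ≥ m}` is symmetric under `B ↦ -B` (`y ↦ -y`).

## References

* R. S. Hamilton, *Four-manifolds with positive curvature operator*, J. Differential Geom. 24
  (1986) 153–179: §2 (pp. 157–158, `M^#` and its block form), §3 (Lemma 3.1, Cor. 3.3, Lemma 3.5,
  pp. 158–159), §4 (Lemma 4.1, Thm. 4.3, pp. 160–162), §5 (5.2 and the case `n = 3`, p. 164:
  "`dm₁/dt = m₁² + m₂m₃ ≥ 0`"), §6 (pp. 165–166, 169), §7 (p. 171: "Note first that `M ≥ 0` is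
  preserved"). [Hamilton1986]
-/

noncomputable section

open Set Filter Topology
open scoped Matrix BigOperators MatrixOrder Manifold ContDiff

namespace Literature.Geometry.Riemannian

namespace HamiltonODE

/-! ### The polarised adjoint `β(X, Y) = (X + Y)^# - X^# - Y^#` -/

/-- Polarisation of Hamilton's quadratic map `X ↦ X^#` on `3 × 3` matrices:
`β(X, Y) = (X + Y)^# - X^# - Y^#`, so that `β(X, X) = 2X^#` — twice Hamilton's symmetric
bilinear operation `P # Q` (1986, p. 169), for which `P^# = P # P`.
[cite: Hamilton1986, §6, p. 169] -/
def polarSharp (X Y : Matrix (Fin 3) (Fin 3) ℝ) : Matrix (Fin 3) (Fin 3) ℝ :=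
  (X + Y).sharp - X.sharp - Y.sharp

/-- `β` is symmetric. [folklore] -/
theorem polarSharp_comm (X Y : Matrix (Fin 3) (Fin 3) ℝ) : polarSharp X Y = polarSharp Y X := by
  unfold polarSharp; rw [add_comm]; abel

/-- `(X + Y)^# = X^# + Y^# + β(X, Y)`. [folklore] -/
theorem sharp_add (X Y : Matrix (Fin 3) (Fin 3) ℝ) :
    (X + Y).sharp = X.sharp + Y.sharp + polarSharp X Y := by
  unfold polarSharp; abel

/-- `β` is additive in the first variable (it is bilinear, `X^#` being quadratic). [folklore] -/
theorem polarSharp_add_left (X X' Y : Matrix (Fin 3) (Fin 3) ℝ) :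
    polarSharp (X + X') Y = polarSharp X Y + polarSharp X' Y := by
  ext i j
  fin_cases i <;> fin_cases j <;>
    simp [polarSharp, Matrix.sharp, Matrix.adjugate_fin_three] <;> ring

/-- `β(0, Y) = 0`. [folklore] -/
theorem polarSharp_zero_left (Y : Matrix (Fin 3) (Fin 3) ℝ) : polarSharp 0 Y = 0 := by
  ext i j
  fin_cases i <;> fin_cases j <;>
    simp [polarSharp, Matrix.sharp, Matrix.adjugate_fin_three]

/-- `β(X, X) = 2X^#` (`X^#` is homogeneous quadratic). [folklore] -/
theorem polarSharp_self (X : Matrix (Fin 3) (Fin 3) ℝ) : polarSharp X X = (2 : ℝ) • X.sharp := by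
  ext i j
  fin_cases i <;> fin_cases j <;>
    simp [polarSharp, Matrix.sharp, Matrix.adjugate_fin_three] <;> ring

/-- `0^# = 0`. [folklore] -/
theorem sharp_zero : (0 : Matrix (Fin 3) (Fin 3) ℝ).sharp = 0 := by
  ext i j
  fin_cases i <;> fin_cases j <;> simp [Matrix.sharp]

/-- `β` is additive over finite sums in the first variable. [folklore] -/
theorem polarSharp_sum_left {κ : Type*} (s : Finset κ) (X : κ → Matrix (Fin 3) (Fin 3) ℝ)
    (Y : Matrix (Fin 3) (Fin 3) ℝ) :
    polarSharp (∑ k ∈ s, X k) Y = ∑ k ∈ s, polarSharp (X k) Y := by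
  classical
  induction s using Finset.induction_on with
  | empty => simp [polarSharp_zero_left]
  | insert a s ha ih => rw [Finset.sum_insert ha, Finset.sum_insert ha, polarSharp_add_left, ih]

/-- **Bilinear expansion of `X^#` over a finite sum**: `2 (Σₖ Xₖ)^# = Σₖ Σₗ β(Xₖ, Xₗ)`.
[folklore] -/
theorem two_smul_sharp_sum {κ : Type*} (s : Finset κ) (X : κ → Matrix (Fin 3) (Fin 3) ℝ) :
    (2 : ℝ) • (∑ k ∈ s, X k).sharp = ∑ k ∈ s, ∑ l ∈ s, polarSharp (X k) (X l) := by
  classical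
  induction s using Finset.induction_on with
  | empty => simp [sharp_zero]
  | insert a s ha ih =>
    rw [Finset.sum_insert ha, sharp_add, smul_add, smul_add, ih, ← polarSharp_self,
      polarSharp_comm (X a) (∑ k ∈ s, X k), polarSharp_sum_left]
    rw [Finset.sum_insert ha, Finset.sum_insert ha]
    simp only [Finset.sum_insert ha, Finset.sum_add_distrib]
    have hc : ∑ k ∈ s, polarSharp (X k) (X a) = ∑ k ∈ s, polarSharp (X a) (X k) :=
      Finset.sum_congr rfl fun k _ ↦ polarSharp_comm _ _
    rw [hc, two_smul]
    abel

/-- **`β` on rank-one matrices is rank one, given by cross products**: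
`β(p qᵀ, p' q'ᵀ) = (p × p')(q × q')ᵀ`. [folklore] -/
theorem polarSharp_vecMulVec (p q p' q' : Fin 3 → ℝ) :
    polarSharp (Matrix.vecMulVec p q) (Matrix.vecMulVec p' q') =
      Matrix.vecMulVec (p ⨯₃ p') (q ⨯₃ q') := by
  ext i j
  fin_cases i <;> fin_cases j <;>
    simp [polarSharp, Matrix.sharp, Matrix.adjugate_fin_three, Matrix.vecMulVec_apply,
      cross_apply] <;> ring

/-- **The Gram identity for `X^#`**: `2 (Σₖ pₖ qₖᵀ)^# = Σₖ Σₗ (pₖ × pₗ)(qₖ × qₗ)ᵀ` (a polarised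
Cauchy–Binet formula for the `2 × 2` minors of `ᵗP Q`). [folklore] -/
theorem two_smul_sharp_gram {κ : Type*} [Fintype κ] (p q : κ → Fin 3 → ℝ) :
    (2 : ℝ) • (∑ k, Matrix.vecMulVec (p k) (q k)).sharp =
      ∑ k, ∑ l, Matrix.vecMulVec (p k ⨯₃ p l) (q k ⨯₃ q l) := by
  rw [two_smul_sharp_sum]
  simp only [polarSharp_vecMulVec]

/-! ### Hamilton's quadratic forms `M(v, v)` and `M^#(v, v)` on `Λ²₊ ⊕ Λ²₋ = ℝ³ × ℝ³` -/

/-- The quadratic form of the curvature operator `M = (A B; ᵗB C)` on `v = (x, y) ∈ Λ²₊ ⊕ Λ²₋`: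
`M(v, v) = ᵗx A x + 2 ᵗx B y + ᵗy C y`. [cite: Hamilton1986, §6, p. 165] -/
def quad (p : Blocks) (v : (Fin 3 → ℝ) × (Fin 3 → ℝ)) : ℝ :=
  v.1 ⬝ᵥ (p.1 *ᵥ v.1) + 2 * (v.1 ⬝ᵥ (p.2.1 *ᵥ v.2)) + v.2 ⬝ᵥ (p.2.2 *ᵥ v.2)

/-- The quadratic form of Hamilton's `M^# = 2 (A^# B^#; ᵗ(B^#) C^#)` (1986, p. 157), halved:
`ᵗx A^# x + 2 ᵗx B^# y + ᵗy C^# y`. [cite: Hamilton1986, §2, pp. 157–158] -/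
def sharpQuad (p : Blocks) (v : (Fin 3 → ℝ) × (Fin 3 → ℝ)) : ℝ :=
  v.1 ⬝ᵥ (p.1.sharp *ᵥ v.1) + 2 * (v.1 ⬝ᵥ (p.2.1.sharp *ᵥ v.2)) + v.2 ⬝ᵥ (p.2.2.sharp *ᵥ v.2)

/-- `|v|² = |x|² + |y|²`. [folklore] -/
def normSq (v : (Fin 3 → ℝ) × (Fin 3 → ℝ)) : ℝ := v.1 ⬝ᵥ v.1 + v.2 ⬝ᵥ v.2

/-- `ᵗx (w ᵗu) z = (x · w)(u · z)`. [folklore] -/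
theorem dotProduct_vecMulVec_mulVec (x w u z : Fin 3 → ℝ) :
    x ⬝ᵥ (Matrix.vecMulVec w u *ᵥ z) = (x ⬝ᵥ w) * (u ⬝ᵥ z) := by
  simp only [dotProduct, Matrix.mulVec, Matrix.vecMulVec_apply, Fin.sum_univ_three]
  ring

/-- A quadratic form against a `2`-scaled matrix. [folklore] -/
theorem dotProduct_two_smul_mulVec (x z : Fin 3 → ℝ) (X : Matrix (Fin 3) (Fin 3) ℝ) :
    x ⬝ᵥ (((2 : ℝ) • X) *ᵥ z) = 2 * (x ⬝ᵥ (X *ᵥ z)) := by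
  rw [Matrix.smul_mulVec, dotProduct_smul, smul_eq_mul]

/-- A quadratic form against a double sum of matrices. [folklore] -/
theorem dotProduct_sum_sum_mulVec {κ : Type*} [Fintype κ] (x z : Fin 3 → ℝ)
    (X : κ → κ → Matrix (Fin 3) (Fin 3) ℝ) :
    x ⬝ᵥ ((∑ k, ∑ l, X k l) *ᵥ z) = ∑ k, ∑ l, x ⬝ᵥ (X k l *ᵥ z) := by
  rw [Matrix.sum_mulVec, dotProduct_sum]
  refine Finset.sum_congr rfl fun k _ ↦ ?_
  rw [Matrix.sum_mulVec, dotProduct_sum]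

/-- **`M^#(v, v)` is a sum of squares on Gram data**: if `A = Σ pₖ ᵗpₖ`, `B = Σ pₖ ᵗqₖ`,
`C = Σ qₖ ᵗqₖ`, then `2 (ᵗx A^# x + 2 ᵗx B^# y + ᵗy C^# y) = Σₖ Σₗ (x · pₖ × pₗ + y · qₖ × qₗ)²`
(the Lie-algebraic identity `M^#(v, v) = ½ Σ λₖ λₗ ⟨[ωₖ, ωₗ], v⟩²` for `so(4) = so(3) ⊕ so(3)`,
`[(p, q), (p', q')] = (p × p', q × q')`). [folklore] -/
theorem two_mul_sharpQuad_gram {κ : Type*} [Fintype κ] (p q : κ → Fin 3 → ℝ)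
    (x y : Fin 3 → ℝ) :
    2 * sharpQuad (∑ k, Matrix.vecMulVec (p k) (p k), ∑ k, Matrix.vecMulVec (p k) (q k),
        ∑ k, Matrix.vecMulVec (q k) (q k)) (x, y) =
      ∑ k, ∑ l, (x ⬝ᵥ (p k ⨯₃ p l) + y ⬝ᵥ (q k ⨯₃ q l)) ^ 2 := by
  have e : ∀ (r r' : κ → Fin 3 → ℝ) (u w : Fin 3 → ℝ),
      2 * (u ⬝ᵥ ((∑ k, Matrix.vecMulVec (r k) (r' k)).sharp *ᵥ w)) =
        ∑ k, ∑ l, (u ⬝ᵥ (r k ⨯₃ r l)) * ((r' k ⨯₃ r' l) ⬝ᵥ w) := by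
    intro r r' u w
    rw [← dotProduct_two_smul_mulVec, two_smul_sharp_gram, dotProduct_sum_sum_mulVec]
    simp only [dotProduct_vecMulVec_mulVec]
  simp only [sharpQuad]
  rw [show ∀ a b c : ℝ, 2 * (a + 2 * b + c) = 2 * a + 2 * (2 * b) + 2 * c by intros; ring,
    e p p x x, e p q x y, e q q y y, Finset.mul_sum, ← Finset.sum_add_distrib,
    ← Finset.sum_add_distrib]
  refine Finset.sum_congr rfl fun k _ ↦ ?_
  rw [Finset.mul_sum, ← Finset.sum_add_distrib, ← Finset.sum_add_distrib]
  refine Finset.sum_congr rfl fun l _ ↦ ?_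
  rw [dotProduct_comm (p k ⨯₃ p l) x, dotProduct_comm (q k ⨯₃ q l) y]
  ring

/-! ### `M ≥ 0` implies `M^# ≥ 0` -/

/-- A positive semidefinite real matrix is a Gram matrix `ᵗN N`. [folklore] -/
theorem exists_transpose_mul_self_of_posSemidef {n : Type*} [Fintype n] [DecidableEq n]
    {S : Matrix n n ℝ} (hS : S.PosSemidef) : ∃ N : Matrix n n ℝ, S = Nᵀ * N := by
  have h0 : (0 : Matrix n n ℝ) ≤ S := Matrix.nonneg_iff_posSemidef.2 hS
  refine ⟨CFC.sqrt S, ?_⟩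
  have h1 : CFC.sqrt S * CFC.sqrt S = S := CFC.sqrt_mul_sqrt_self S h0
  have h2 : (CFC.sqrt S).PosSemidef := Matrix.nonneg_iff_posSemidef.1 (CFC.sqrt_nonneg S)
  have h3 : (CFC.sqrt S)ᴴ = CFC.sqrt S := h2.1
  rw [Matrix.conjTranspose_eq_transpose_of_trivial] at h3
  rw [h3, h1]

/-- The quadratic form of the block matrix `(A B; ᵗB C)` on `x ⊕ y` is `M(v, v)`. [folklore] -/
theorem sumElim_dotProduct_fromBlocks_mulVec (A B C : Matrix (Fin 3) (Fin 3) ℝ)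
    (x y : Fin 3 → ℝ) :
    Sum.elim x y ⬝ᵥ (Matrix.fromBlocks A B Bᵀ C *ᵥ Sum.elim x y) = quad (A, B, C) (x, y) := by
  rw [Matrix.fromBlocks_mulVec, Sum.elim_comp_inl, Sum.elim_comp_inr,
    sumElim_dotProduct_sumElim, dotProduct_add, dotProduct_add, Matrix.dotProduct_transpose_mulVec]
  simp only [quad]
  ring

/-- **If `M = (A B; ᵗB C) ≥ 0` (with `A`, `C` symmetric) then `M^#(v, v) ≥ 0` for every
`v = (x, y)`**: the block form of "`M ≥ 0 ⇒ M^# ≥ 0`", the algebraic heart of "M ≥ 0 is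
preserved" (Hamilton 1986, §7, p. 171; §5, p. 164 for `n = 3`: `dm₁/dt = m₁² + m₂m₃ ≥ 0`).
Proof: `M = ᵗN N` is a Gram matrix and `two_mul_sharpQuad_gram`. [cite: Hamilton1986, §7, p. 171] -/
theorem sharpQuad_nonneg_of_quad_nonneg {p : Blocks} (hA : p.1.IsSymm) (hC : p.2.2.IsSymm)
    (h : ∀ v, 0 ≤ quad p v) (v : (Fin 3 → ℝ) × (Fin 3 → ℝ)) : 0 ≤ sharpQuad p v := by
  obtain ⟨A, B, C⟩ := p
  obtain ⟨x, y⟩ := v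
  set S : Matrix (Fin 3 ⊕ Fin 3) (Fin 3 ⊕ Fin 3) ℝ := Matrix.fromBlocks A B Bᵀ C with hSdef
  have hSh : S.IsHermitian := by
    change Sᴴ = S
    rw [Matrix.conjTranspose_eq_transpose_of_trivial, hSdef, Matrix.fromBlocks_transpose,
      Matrix.transpose_transpose]
    have hA' : Aᵀ = A := hA.eq
    have hC' : Cᵀ = C := hC.eq
    rw [hA', hC']
  have hS : S.PosSemidef := by
    refine Matrix.PosSemidef.of_dotProduct_mulVec_nonneg hSh fun w ↦ ?_
    rw [star_trivial, ← Sum.elim_comp_inl_inr w, hSdef, sumElim_dotProduct_fromBlocks_mulVec]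
    exact h _
  obtain ⟨N, hN⟩ := exists_transpose_mul_self_of_posSemidef hS
  set P : Fin 3 ⊕ Fin 3 → Fin 3 → ℝ := fun k i ↦ N k (Sum.inl i) with hP
  set Q : Fin 3 ⊕ Fin 3 → Fin 3 → ℝ := fun k i ↦ N k (Sum.inr i) with hQ
  have hAe : A = ∑ k, Matrix.vecMulVec (P k) (P k) := by
    ext i j
    have := congr_fun (congr_fun hN (Sum.inl i)) (Sum.inl j)
    rw [hSdef, Matrix.fromBlocks_apply₁₁, Matrix.mul_apply] at this
    rw [this, Matrix.sum_apply]
    simp [hP, Matrix.vecMulVec_apply]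
  have hBe : B = ∑ k, Matrix.vecMulVec (P k) (Q k) := by
    ext i j
    have := congr_fun (congr_fun hN (Sum.inl i)) (Sum.inr j)
    rw [hSdef, Matrix.fromBlocks_apply₁₂, Matrix.mul_apply] at this
    rw [this, Matrix.sum_apply]
    simp [hP, hQ, Matrix.vecMulVec_apply]
  have hCe : C = ∑ k, Matrix.vecMulVec (Q k) (Q k) := by
    ext i j
    have := congr_fun (congr_fun hN (Sum.inr i)) (Sum.inr j)
    rw [hSdef, Matrix.fromBlocks_apply₂₂, Matrix.mul_apply] at this
    rw [this, Matrix.sum_apply]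
    simp [hQ, Matrix.vecMulVec_apply]
  have key := two_mul_sharpQuad_gram P Q x y
  rw [← hAe, ← hBe, ← hCe] at key
  have hsq : 0 ≤ ∑ k, ∑ l, (x ⬝ᵥ (P k ⨯₃ P l) + y ⬝ᵥ (Q k ⨯₃ Q l)) ^ 2 :=
    Finset.sum_nonneg fun k _ ↦ Finset.sum_nonneg fun l _ ↦ sq_nonneg _
  linarith


/-! ### Linear structure, symmetry, homogeneity and continuity of `M(v, v)` -/

/-- `M(v, v)` is additive in `M`. [folklore] -/
theorem quad_add_left (p q : Blocks) (v : (Fin 3 → ℝ) × (Fin 3 → ℝ)) :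
    quad (p + q) v = quad p v + quad q v := by
  simp only [quad, Prod.fst_add, Prod.snd_add, Matrix.add_mulVec, dotProduct_add]
  ring

/-- `M(v, v)` is homogeneous in `M`. [folklore] -/
theorem quad_smul_left (c : ℝ) (p : Blocks) (v : (Fin 3 → ℝ) × (Fin 3 → ℝ)) :
    quad (c • p) v = c * quad p v := by
  simp only [quad, Prod.smul_fst, Prod.smul_snd, Matrix.smul_mulVec, dotProduct_smul, smul_eq_mul]
  ring

/-- `quad 0 = 0`. [folklore] -/
@[simp] theorem quad_zero_left (v : (Fin 3 → ℝ) × (Fin 3 → ℝ)) : quad 0 v = 0 := by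
  simp [quad]

/-- `M(0, 0) = 0`. [folklore] -/
@[simp] theorem quad_zero_right (p : Blocks) : quad p 0 = 0 := by
  simp [quad]

/-- The identity of `Λ²` in block form: `(1 0; 0 1)`. [folklore] -/
def idBlocks : Blocks := (1, 0, 1)

/-- `1(v, v) = |v|²`. [folklore] -/
@[simp] theorem quad_idBlocks (v : (Fin 3 → ℝ) × (Fin 3 → ℝ)) : quad idBlocks v = normSq v := by
  simp [quad, idBlocks, normSq]

/-- `(M + t)(v, v) = M(v, v) + t |v|²`. [folklore] -/
theorem quad_add_smul_idBlocks (p : Blocks) (t : ℝ) (v : (Fin 3 → ℝ) × (Fin 3 → ℝ)) :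
    quad (p + t • idBlocks) v = quad p v + t * normSq v := by
  rw [quad_add_left, quad_smul_left, quad_idBlocks]

/-- Reflecting `B ↦ -B` amounts to `y ↦ -y`. [folklore] -/
theorem quad_reflectB (p : Blocks) (x y : Fin 3 → ℝ) :
    quad (reflectB p) (x, y) = quad p (x, -y) := by
  simp only [quad, reflectB, Matrix.neg_mulVec, Matrix.mulVec_neg, dotProduct_neg, neg_dotProduct]
  ring

/-- `|(x, -y)|² = |(x, y)|²`. [folklore] -/
@[simp] theorem normSq_neg_snd (x y : Fin 3 → ℝ) : normSq (x, -y) = normSq (x, y) := by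
  simp [normSq]

/-- `M(cv, cv) = c² M(v, v)`. [folklore] -/
theorem quad_smul_right (p : Blocks) (c : ℝ) (v : (Fin 3 → ℝ) × (Fin 3 → ℝ)) :
    quad p (c • v) = c ^ 2 * quad p v := by
  obtain ⟨x, y⟩ := v
  simp only [quad, Prod.smul_mk, Matrix.mulVec_smul, dotProduct_smul, smul_dotProduct, smul_eq_mul]
  ring

/-- `|cv|² = c² |v|²`. [folklore] -/
theorem normSq_smul (c : ℝ) (v : (Fin 3 → ℝ) × (Fin 3 → ℝ)) :
    normSq (c • v) = c ^ 2 * normSq v := by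
  obtain ⟨x, y⟩ := v
  simp only [normSq, Prod.smul_mk, dotProduct_smul, smul_dotProduct, smul_eq_mul]
  ring

/-- `|v|² ≥ 0`. [folklore] -/
theorem normSq_nonneg (v : (Fin 3 → ℝ) × (Fin 3 → ℝ)) : 0 ≤ normSq v :=
  add_nonneg (Finset.sum_nonneg fun _ _ ↦ mul_self_nonneg _)
    (Finset.sum_nonneg fun _ _ ↦ mul_self_nonneg _)

/-- `|v|² = 0` only for `v = 0`. [folklore] -/
theorem eq_zero_of_normSq_eq_zero {v : (Fin 3 → ℝ) × (Fin 3 → ℝ)} (h : normSq v = 0) : v = 0 := by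
  obtain ⟨x, y⟩ := v
  have hx : 0 ≤ x ⬝ᵥ x := Finset.sum_nonneg fun i _ ↦ mul_self_nonneg _
  have hy : 0 ≤ y ⬝ᵥ y := Finset.sum_nonneg fun i _ ↦ mul_self_nonneg _
  simp only [normSq] at h
  have hx0 : x ⬝ᵥ x = 0 := by linarith
  have hy0 : y ⬝ᵥ y = 0 := by linarith
  rw [dotProduct_self_eq_zero] at hx0 hy0
  simp [hx0, hy0]

/-- `(M, v) ↦ M(v, v)` is continuous. [folklore] -/
theorem continuous_quad :
    Continuous fun z : Blocks × ((Fin 3 → ℝ) × (Fin 3 → ℝ)) ↦ quad z.1 z.2 := by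
  unfold quad
  have h := continuous_quadForm
  have hA : Continuous fun z : Blocks × ((Fin 3 → ℝ) × (Fin 3 → ℝ)) ↦ z.1.1 := continuous_fst.fst
  have hB : Continuous fun z : Blocks × ((Fin 3 → ℝ) × (Fin 3 → ℝ)) ↦ z.1.2.1 :=
    continuous_fst.snd.fst
  have hC : Continuous fun z : Blocks × ((Fin 3 → ℝ) × (Fin 3 → ℝ)) ↦ z.1.2.2 :=
    continuous_fst.snd.snd
  have hx : Continuous fun z : Blocks × ((Fin 3 → ℝ) × (Fin 3 → ℝ)) ↦ z.2.1 := continuous_snd.fst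
  have hy : Continuous fun z : Blocks × ((Fin 3 → ℝ) × (Fin 3 → ℝ)) ↦ z.2.2 := continuous_snd.snd
  exact ((h.comp (hA.prodMk (hx.prodMk hx))).add
    (continuous_const.mul (h.comp (hB.prodMk (hx.prodMk hy))))).add
    (h.comp (hC.prodMk (hy.prodMk hy)))

/-- `v ↦ |v|²` is continuous. [folklore] -/
theorem continuous_normSq : Continuous fun v : ((Fin 3 → ℝ) × (Fin 3 → ℝ)) ↦ normSq v :=
  (continuous_fst.dotProduct continuous_fst).add (continuous_snd.dotProduct continuous_snd)

/-- The derivative of `M(v, v)` along a differentiable curve of block triples. [folklore] -/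
theorem hasDerivAt_quad {γ : ℝ → Blocks} {γ' : Blocks} {s : ℝ} (h : HasDerivAt γ γ' s)
    (v : (Fin 3 → ℝ) × (Fin 3 → ℝ)) :
    _root_.HasDerivAt (fun t ↦ quad (γ t) v) (quad γ' v) s := by
  obtain ⟨x, y⟩ := v
  have h1 := hasDerivAt_quadForm h.1 x x
  have h2 := hasDerivAt_quadForm h.2.1 x y
  have h3 := hasDerivAt_quadForm h.2.2 y y
  exact (h1.add (h2.const_mul 2)).add h3

/-! ### The evolution of `M(v, v)` under Hamilton's ODE -/

/-- **Hamilton's ODE tested against a fixed `2`-vector**: for `A`, `C` symmetric,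
`M'(v, v) = |M v|² + 2 · (ᵗx A^# x + 2 ᵗx B^# y + ᵗy C^# y)` where `M' = M² + M^#` is Hamilton's
field in block form (`HamiltonODE.field`) and `M v = (Ax + By, ᵗBx + Cy)`.
[cite: Hamilton1986, §2, pp. 157–158; §6, p. 166] -/
theorem quad_field {p : Blocks} (hA : p.1.IsSymm) (hC : p.2.2.IsSymm) (x y : Fin 3 → ℝ) :
    quad (field p) (x, y) =
      (p.1 *ᵥ x + p.2.1 *ᵥ y) ⬝ᵥ (p.1 *ᵥ x + p.2.1 *ᵥ y) +
        (p.2.1ᵀ *ᵥ x + p.2.2 *ᵥ y) ⬝ᵥ (p.2.1ᵀ *ᵥ x + p.2.2 *ᵥ y) + 2 * sharpQuad p (x, y) := by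
  obtain ⟨A, B, C⟩ := p
  have a10 : A 1 0 = A 0 1 := hA.apply 0 1
  have a20 : A 2 0 = A 0 2 := hA.apply 0 2
  have a21 : A 2 1 = A 1 2 := hA.apply 1 2
  have c10 : C 1 0 = C 0 1 := hC.apply 0 1
  have c20 : C 2 0 = C 0 2 := hC.apply 0 2
  have c21 : C 2 1 = C 1 2 := hC.apply 1 2
  simp only [quad, sharpQuad, field, dotProduct, Matrix.mulVec, Matrix.add_apply,
    Matrix.smul_apply, Matrix.mul_apply, Matrix.transpose_apply, Fin.sum_univ_three, smul_eq_mul,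
    Pi.add_apply]
  rw [a10, a20, a21, c10, c20, c21]
  ring

/-- Consequently `M'(v, v) ≥ 2 · (ᵗx A^# x + 2 ᵗx B^# y + ᵗy C^# y)`. [folklore] -/
theorem two_mul_sharpQuad_le_quad_field {p : Blocks} (hA : p.1.IsSymm) (hC : p.2.2.IsSymm)
    (v : (Fin 3 → ℝ) × (Fin 3 → ℝ)) : 2 * sharpQuad p v ≤ quad (field p) v := by
  obtain ⟨x, y⟩ := v
  rw [quad_field hA hC]
  have h1 : 0 ≤ (p.1 *ᵥ x + p.2.1 *ᵥ y) ⬝ᵥ (p.1 *ᵥ x + p.2.1 *ᵥ y) :=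
    Finset.sum_nonneg fun i _ ↦ mul_self_nonneg _
  have h2 : 0 ≤ (p.2.1ᵀ *ᵥ x + p.2.2 *ᵥ y) ⬝ᵥ (p.2.1ᵀ *ᵥ x + p.2.2 *ᵥ y) :=
    Finset.sum_nonneg fun i _ ↦ mul_self_nonneg _
  linarith

/-! ### Shifting by the identity: `(M + t)^#` -/

/-- `(A + t)^# = A^# + t (tr A · 1 - ᵗA) + t² · 1` for `3 × 3` matrices. [folklore] -/
theorem sharp_add_smul_one (A : Matrix (Fin 3) (Fin 3) ℝ) (t : ℝ) :
    (A + t • (1 : Matrix (Fin 3) (Fin 3) ℝ)).sharp =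
      A.sharp + t • (A.trace • (1 : Matrix (Fin 3) (Fin 3) ℝ) - Aᵀ) +
        (t ^ 2) • (1 : Matrix (Fin 3) (Fin 3) ℝ) := by
  ext i j
  fin_cases i <;> fin_cases j <;>
    simp [Matrix.sharp, Matrix.adjugate_fin_three, Matrix.trace, Fin.sum_univ_three] <;> ring

/-- The first-order term of `(M + t)^#(v, v)`: `tr A |x|² - ᵗx ᵗA x + tr C |y|² - ᵗy ᵗC y`.
[folklore] -/
def traceForm (p : Blocks) (v : (Fin 3 → ℝ) × (Fin 3 → ℝ)) : ℝ :=
  p.1.trace * (v.1 ⬝ᵥ v.1) - v.1 ⬝ᵥ (p.1ᵀ *ᵥ v.1) +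
    (p.2.2.trace * (v.2 ⬝ᵥ v.2) - v.2 ⬝ᵥ (p.2.2ᵀ *ᵥ v.2))

/-- **`(M + t)^#(v, v) = M^#(v, v) + t · traceForm + t² |v|²`** (the `B`-block is not shifted).
[folklore] -/
theorem sharpQuad_add_smul_idBlocks (p : Blocks) (t : ℝ) (v : (Fin 3 → ℝ) × (Fin 3 → ℝ)) :
    sharpQuad (p + t • idBlocks) v = sharpQuad p v + t * traceForm p v + t ^ 2 * normSq v := by
  obtain ⟨A, B, C⟩ := p
  obtain ⟨x, y⟩ := v
  have e1 : (((A, B, C) : Blocks) + t • idBlocks).1 = A + t • (1 : Matrix (Fin 3) (Fin 3) ℝ) := by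
    simp [idBlocks]
  have e2 : (((A, B, C) : Blocks) + t • idBlocks).2.1 = B := by simp [idBlocks]
  have e3 : (((A, B, C) : Blocks) + t • idBlocks).2.2 = C + t • (1 : Matrix (Fin 3) (Fin 3) ℝ) := by
    simp [idBlocks]
  simp only [sharpQuad, traceForm, normSq, e1, e2, e3, sharp_add_smul_one, Matrix.add_mulVec,
    Matrix.smul_mulVec, Matrix.sub_mulVec, Matrix.one_mulVec, dotProduct_add, dotProduct_smul,
    dotProduct_sub, smul_eq_mul]
  ring

/-- `(p, v) ↦ traceForm p v` is continuous. [folklore] -/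
theorem continuous_traceForm :
    Continuous fun z : Blocks × ((Fin 3 → ℝ) × (Fin 3 → ℝ)) ↦ traceForm z.1 z.2 := by
  unfold traceForm
  have h := continuous_quadForm
  have hA : Continuous fun z : Blocks × ((Fin 3 → ℝ) × (Fin 3 → ℝ)) ↦ z.1.1 := continuous_fst.fst
  have hC : Continuous fun z : Blocks × ((Fin 3 → ℝ) × (Fin 3 → ℝ)) ↦ z.1.2.2 :=
    continuous_fst.snd.snd
  have hx : Continuous fun z : Blocks × ((Fin 3 → ℝ) × (Fin 3 → ℝ)) ↦ z.2.1 := continuous_snd.fst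
  have hy : Continuous fun z : Blocks × ((Fin 3 → ℝ) × (Fin 3 → ℝ)) ↦ z.2.2 := continuous_snd.snd
  have htr : ∀ {f : Blocks × ((Fin 3 → ℝ) × (Fin 3 → ℝ)) → Matrix (Fin 3) (Fin 3) ℝ}, Continuous f →
      Continuous fun z ↦ (f z).trace := fun hf ↦ by
    simp only [Matrix.trace]
    exact continuous_finsetSum _ fun i _ ↦ hf.matrix_elem i i
  exact (((htr hA).mul (hx.dotProduct hx)).sub (h.comp (hA.matrix_transpose.prodMk
    (hx.prodMk hx)))).add
    (((htr hC).mul (hy.dotProduct hy)).sub (h.comp (hC.matrix_transpose.prodMk (hy.prodMk hy))))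

/-- Continuity of `(M, v) ↦ traceForm (M - M(v,v)·1) v`, the first-order term after shifting by
the value of the form. [folklore] -/
theorem continuous_shiftedTraceForm :
    Continuous fun z : Blocks × ((Fin 3 → ℝ) × (Fin 3 → ℝ)) ↦
      traceForm (z.1 + (-quad z.1 z.2) • idBlocks) z.2 :=
  continuous_traceForm.comp
    ((continuous_fst.add (continuous_quad.neg.smul continuous_const)).prodMk continuous_snd)

/-! ### `M ≥ m` as a closed convex reflection-symmetric condition on block triples -/

/-- **`M ≥ m`** for the curvature operator `M = (A B; ᵗB C)` of a block triple:
`M(v, v) ≥ m |v|²` for all `v ∈ Λ²₊ ⊕ Λ²₋` (Hamilton 1986: `M ≥ 0`, `M > 0`; `m = 0` is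
"nonnegative curvature operator"). [cite: Hamilton1986, §1, p. 153; §7, p. 171] -/
def OperatorGE (p : Blocks) (m : ℝ) : Prop :=
  ∀ v : (Fin 3 → ℝ) × (Fin 3 → ℝ), m * normSq v ≤ quad p v

/-- The unit sphere of `Λ²₊ ⊕ Λ²₋ = ℝ⁶`. [folklore] -/
def sphere6 : Set ((Fin 3 → ℝ) × (Fin 3 → ℝ)) := {v | normSq v = 1}

/-- A vector of `ℝ³` with `u · u ≤ 1` has sup norm `≤ 1`. [folklore] -/
theorem norm_le_one_of_dotProduct_self_le {u : Fin 3 → ℝ} (hu : u ⬝ᵥ u ≤ 1) : ‖u‖ ≤ 1 := by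
  rw [pi_norm_le_iff_of_nonneg zero_le_one]
  intro i
  have h1 : u i * u i ≤ u ⬝ᵥ u :=
    Finset.single_le_sum (f := fun j ↦ u j * u j) (fun j _ ↦ mul_self_nonneg (u j))
      (Finset.mem_univ i)
  rw [Real.norm_eq_abs]
  exact abs_le_one_iff_mul_self_le_one.2 (h1.trans hu)

/-- The unit sphere of `ℝ⁶` is compact. [folklore] -/
theorem isCompact_sphere6 : IsCompact sphere6 := by
  refine (isCompact_closedBall (0 : (Fin 3 → ℝ) × (Fin 3 → ℝ)) 1).of_isClosed_subset
    (isClosed_eq continuous_normSq continuous_const) ?_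
  rintro ⟨x, y⟩ hv
  have hx : 0 ≤ x ⬝ᵥ x := Finset.sum_nonneg fun i _ ↦ mul_self_nonneg _
  have hy : 0 ≤ y ⬝ᵥ y := Finset.sum_nonneg fun i _ ↦ mul_self_nonneg _
  simp only [sphere6, normSq, mem_setOf_eq] at hv
  rw [Metric.mem_closedBall, dist_zero_right, Prod.norm_def, max_le_iff]
  exact ⟨norm_le_one_of_dotProduct_self_le (by linarith),
    norm_le_one_of_dotProduct_self_le (by linarith)⟩

/-- The unit sphere of `ℝ⁶` is nonempty. [folklore] -/
theorem sphere6_nonempty : sphere6.Nonempty :=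
  ⟨(![1, 0, 0], ![0, 0, 0]), by simp [sphere6, normSq, dotProduct, Fin.sum_univ_three]⟩

/-- **From the sphere to all of `Λ²`** (homogeneity): a lower bound `M(w, w) ≥ m` on unit
vectors gives `M ≥ m`. [folklore] -/
theorem operatorGE_of_sphere6 {p : Blocks} {m : ℝ} (h : ∀ w ∈ sphere6, m ≤ quad p w) :
    OperatorGE p m := by
  intro v
  rcases eq_or_lt_of_le (normSq_nonneg v) with h0 | hpos
  · rw [eq_zero_of_normSq_eq_zero h0.symm, quad_zero_right]
    simp [normSq]
  · set r := normSq v with hr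
    set c : ℝ := (Real.sqrt r)⁻¹ with hc
    have hsq : c ^ 2 * r = 1 := by
      rw [hc, inv_pow, Real.sq_sqrt hpos.le, inv_mul_cancel₀ hpos.ne']
    have hc2 : 0 < c ^ 2 := by positivity
    have hmem : c • v ∈ sphere6 := by
      show normSq (c • v) = 1
      rw [normSq_smul, ← hr, hsq]
    have h1 := h _ hmem
    rw [quad_smul_right] at h1
    have h2 : m * r = c ^ 2 * r * (m * r) := by rw [hsq, one_mul]
    rw [h2]
    nlinarith

/-- Conversely `M ≥ m` bounds `M(w, w)` below by `m` on the sphere. [folklore] -/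
theorem OperatorGE.le_quad {p : Blocks} {m : ℝ} (h : OperatorGE p m) {w : (Fin 3 → ℝ) × (Fin 3 → ℝ)}
    (hw : w ∈ sphere6) :
    m ≤ quad p w := by
  have := h w
  rw [show normSq w = 1 from hw, mul_one] at this
  exact this

/-- `{M ≥ m}` is closed. [folklore] -/
theorem isClosed_operatorGE (m : ℝ) : IsClosed {p : Blocks | OperatorGE p m} := by
  simp only [OperatorGE, setOf_forall]
  refine isClosed_iInter fun v ↦ ?_
  exact isClosed_le continuous_const (continuous_quad.comp (continuous_id.prodMk continuous_const))

/-- `{M ≥ m}` is convex (chord form: `M(v, v)` is linear in `M`). [folklore] -/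
theorem OperatorGE.combo {p q : Blocks} {m : ℝ} (hp : OperatorGE p m) (hq : OperatorGE q m)
    {a b : ℝ} (ha : 0 ≤ a) (hb : 0 ≤ b) (hab : a + b = 1) : OperatorGE (a • p + b • q) m := by
  intro v
  rw [quad_add_left, quad_smul_left, quad_smul_left]
  have h1 := mul_le_mul_of_nonneg_left (hp v) ha
  have h2 := mul_le_mul_of_nonneg_left (hq v) hb
  have : m * normSq v = a * (m * normSq v) + b * (m * normSq v) := by rw [← add_mul, hab, one_mul]
  linarith

/-- `{M ≥ m}` is convex. [folklore] -/
theorem convex_operatorGE (m : ℝ) : Convex ℝ {p : Blocks | OperatorGE p m} :=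
  fun _ hp _ hq _ _ ha hb hab ↦ hp.combo hq ha hb hab

/-- `{M ≥ m}` is symmetric under `B ↦ -B`. [folklore] -/
theorem OperatorGE.reflectB {p : Blocks} {m : ℝ} (h : OperatorGE p m) :
    OperatorGE (reflectB p) m := by
  rintro ⟨x, y⟩
  rw [quad_reflectB, ← normSq_neg_snd]
  exact h (x, -y)

/-- `M ≥ m` with `m ≥ 0` implies `M ≥ 0`. [folklore] -/
theorem OperatorGE.nonneg {p : Blocks} {m : ℝ} (h : OperatorGE p m) (hm : 0 ≤ m)
    (v : (Fin 3 → ℝ) × (Fin 3 → ℝ)) :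
    0 ≤ quad p v :=
  (mul_nonneg hm (normSq_nonneg v)).trans (h v)

/-! ### `M ≥ m` is preserved by Hamilton's ODE (`m ≥ 0`) -/

section Preserved

variable {γ : ℝ → Blocks} {t₀ t₁ : ℝ}

/-- The family `G(s, w) = M_s(w, w) - m |w|²` and its derivative are continuous along a solution.
[folklore] -/
theorem continuousOn_quad_comp {δ : ℝ → Blocks} (hδ : ContinuousOn δ (Icc t₀ t₁)) (m : ℝ) :
    ContinuousOn (fun q : ℝ × ((Fin 3 → ℝ) × (Fin 3 → ℝ)) ↦ quad (δ q.1) q.2 - m * normSq q.2)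
      (Icc t₀ t₁ ×ˢ sphere6) := by
  have h1 : ContinuousOn (fun q : ℝ × ((Fin 3 → ℝ) × (Fin 3 → ℝ)) ↦ (δ q.1, q.2))
      (Icc t₀ t₁ ×ˢ sphere6) :=
    (hδ.comp continuousOn_fst fun q hq ↦ (mem_prod.1 hq).1).prodMk continuousOn_snd
  exact (continuous_quad.comp_continuousOn h1).sub
    ((continuous_const.mul continuous_normSq).comp_continuousOn continuousOn_snd)

/-- **At a minimiser on the sphere the minimum value bounds `M` below on all of `Λ²`.**
[folklore] -/
theorem quad_ge_of_isMinOn {p : Blocks} {m : ℝ} {v : (Fin 3 → ℝ) × (Fin 3 → ℝ)} (hv : v ∈ sphere6)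
    (hmin : IsMinOn (fun w ↦ quad p w - m * normSq w) sphere6 v) (w : (Fin 3 → ℝ) × (Fin 3 → ℝ)) :
    quad p v * normSq w ≤ quad p w := by
  refine operatorGE_of_sphere6 (fun u hu ↦ ?_) w
  have h : quad p v - m * normSq v ≤ quad p u - m * normSq u := hmin hu
  rw [show normSq u = 1 from hu, show normSq v = 1 from hv] at h
  linarith

/-- **Hamilton 1986, §7 (p. 171): "`M ≥ 0` is preserved" — and so is `M ≥ m` for every
`m ≥ 0` — by the ODE `M' = M² + M^#`**, in block form and relative to the phase space
`{A, C symmetric}` of symmetric forms on `Λ²` (itself invariant, `isInvariant_isSymm`): the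
set `{M ≥ m}` (`OperatorGE`) is forward invariant under `HamiltonODE.field`. Proof, as in the
model case `n = 3` of §5 (p. 164: "`dm₁/dt = m₁² + m₂m₃ ≥ 0`"): `λ(t) = min_{|v| = 1} M_t(v, v)`
is a minimum over a compact set, and at a minimiser `v` Hamilton's Lipschitz calculus (§3,
Lemmas 3.1, 3.5; `minOverSet_nonneg_of_deriv`) only needs the sign of
`M'(v, v) = |Mv|² + M^#(v, v)` (`quad_field`); for `λ > 0` one has `M ≥ 0`, hence
`M^#(v, v) ≥ 0` (`sharpQuad_nonneg_of_quad_nonneg`); for `m = 0` and `λ ≤ 0` slightly negative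
one writes `M = M₀ + λ` with `M₀ ≥ 0`, `M^#(v,v) = M₀^#(v,v) + λ · traceForm + λ² ≥ C λ`
(`sharpQuad_add_smul_idBlocks`), the one-sided linear bound of Cor. 3.3.
[cite: Hamilton1986, §7, p. 171 ("Note first that M ≥ 0 is preserved")]
[cite: Hamilton1986, §5, p. 164; §3, Lemma 3.1, Cor. 3.3, Lemma 3.5 (pp. 158–159)] -/
theorem isInvariantRel_operatorGE {m : ℝ} (hm : 0 ≤ m) :
    IsInvariantRel field (fun _ ↦ {p : Blocks | p.1.IsSymm ∧ p.2.2.IsSymm})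
      (fun _ ↦ {p | OperatorGE p m}) := by
  intro γ t₀ t₁ _ h₁ hγ hK hin
  have hγc : ContinuousOn γ (Icc t₀ t₁) := IsSolutionOn.continuousOn hγ
  have hγ'c : ContinuousOn (fun s ↦ field (γ s)) (Icc t₀ t₁) :=
    continuous_field.comp_continuousOn hγc
  have hGc := continuousOn_quad_comp hγc m
  have hG'c : ContinuousOn (fun q : ℝ × ((Fin 3 → ℝ) × (Fin 3 → ℝ)) ↦ quad (field (γ q.1)) q.2)
      (Icc t₀ t₁ ×ˢ sphere6) :=
    (continuousOn_quad_comp hγ'c 0).congr fun q _ ↦ by simp only [zero_mul, sub_zero]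
  have hGd : ∀ w ∈ sphere6, ∀ s ∈ Icc t₀ t₁,
      _root_.HasDerivAt (fun t ↦ quad (γ t) w - m * normSq w) (quad (field (γ s)) w) s := by
    intro w _ s hs
    simpa using (hasDerivAt_quad (hγ s hs) w).sub_const (m * normSq w)
  -- a uniform bound for the first-order term along the solution (used when `m = 0`)
  obtain ⟨K', hK'0, hK'⟩ : ∃ K' : ℝ, 0 ≤ K' ∧ ∀ s ∈ Icc t₀ t₁, ∀ w ∈ sphere6,
      traceForm (γ s + (-quad (γ s) w) • idBlocks) w ≤ K' := by
    have hf : ContinuousOn (fun q : ℝ × ((Fin 3 → ℝ) × (Fin 3 → ℝ)) ↦ (γ q.1, q.2))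
        (Icc t₀ t₁ ×ˢ sphere6) :=
      (hγc.comp continuousOn_fst fun q hq ↦ (mem_prod.1 hq).1).prodMk continuousOn_snd
    have hcont := continuous_shiftedTraceForm.comp_continuousOn hf
    obtain ⟨K₀, hK₀⟩ := (isCompact_Icc.prod isCompact_sphere6).bddAbove_image hcont
    refine ⟨max K₀ 0, le_max_right _ _, fun s hs w hw ↦ ?_⟩
    exact (hK₀ ⟨(s, w), ⟨hs, hw⟩, rfl⟩).trans (le_max_left _ _)
  -- Hamilton's Lemma 3.1 / Cor. 3.3 for the minimum over the sphere
  have hη : 0 < max m 1 := lt_max_of_lt_right one_pos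
  have key := minOverSet_nonneg_of_deriv (G := fun t w ↦ quad (γ t) w - m * normSq w)
    (G' := fun t w ↦ quad (field (γ t)) w) isCompact_sphere6 sphere6_nonempty hGc hGd hG'c h₁
    hη (mul_nonneg two_pos.le hK'0) (η := max m 1) (C := 2 * K') ?sign ?init
  · refine operatorGE_of_sphere6 fun w hw ↦ ?_
    have h := (le_minOverSet_iff isCompact_sphere6 sphere6_nonempty
      (continuousOn_slice (G := fun t w ↦ quad (γ t) w - m * normSq w) hGc
        (right_mem_Icc.2 h₁)) 0).1 key w hw
    simp only [show normSq w = 1 from hw, mul_one, sub_nonneg] at h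
    exact h
  case init =>
    refine (le_minOverSet_iff isCompact_sphere6 sphere6_nonempty
      (continuousOn_slice (G := fun t w ↦ quad (γ t) w - m * normSq w) hGc
        (left_mem_Icc.2 h₁)) 0).2 fun w hw ↦ ?_
    have := (hin : OperatorGE (γ t₀) m) w
    show 0 ≤ quad (γ t₀) w - m * normSq w
    linarith
  case sign =>
    intro s hs v hv hvmin hlow hup
    have hsI : s ∈ Icc t₀ t₁ := Ico_subset_Icc_self hs
    obtain ⟨hA, hC⟩ := hK s hsI
    have hv1 : normSq v = 1 := hv
    simp only [hv1, mul_one] at hlow hup ⊢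
    set p := γ s with hp
    set lam := quad p v with hlam
    -- the minimum value bounds `M` below everywhere
    have hlow' : ∀ w, lam * normSq w ≤ quad p w := quad_ge_of_isMinOn hv hvmin
    have hfield := two_mul_sharpQuad_le_quad_field hA hC v
    rcases lt_or_ge 0 lam with hpos | hnonpos
    · -- `λ > 0`: `M ≥ 0`, so `M^#(v, v) ≥ 0` and `M'(v, v) ≥ 0 ≥ C (λ - m)`
      have hnn : ∀ w, 0 ≤ quad p w := fun w ↦
        (mul_nonneg hpos.le (normSq_nonneg w)).trans (hlow' w)
      have hsharp := sharpQuad_nonneg_of_quad_nonneg hA hC hnn v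
      nlinarith
    · -- `λ ≤ 0` (only possible for `m = 0`): shift by `λ`
      set p₀ : Blocks := p + (-lam) • idBlocks with hp₀
      have hpp : p = p₀ + lam • idBlocks := by
        rw [hp₀, add_assoc, ← add_smul, neg_add_cancel, zero_smul, add_zero]
      have hA₀ : p₀.1.IsSymm := by
        simpa [hp₀, idBlocks] using hA.add ((Matrix.isSymm_one).smul (-lam))
      have hC₀ : p₀.2.2.IsSymm := by
        simpa [hp₀, idBlocks] using hC.add ((Matrix.isSymm_one).smul (-lam))
      have hnn₀ : ∀ w, 0 ≤ quad p₀ w := fun w ↦ by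
        rw [hp₀, quad_add_smul_idBlocks]
        linarith [hlow' w]
      have hsharp₀ := sharpQuad_nonneg_of_quad_nonneg hA₀ hC₀ hnn₀ v
      have hshift : sharpQuad p v = sharpQuad p₀ v + lam * traceForm p₀ v + lam ^ 2 * normSq v := by
        conv_lhs => rw [hpp]
        exact sharpQuad_add_smul_idBlocks p₀ lam v
      have htr : traceForm p₀ v ≤ K' := hK' s hsI v hv
      have h1 : lam * K' ≤ lam * traceForm p₀ v := mul_le_mul_of_nonpos_left htr hnonpos
      have h2 : 0 ≤ lam ^ 2 * normSq v := by positivity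
      have hm0 : m * lam ≤ m * 0 := mul_le_mul_of_nonneg_left hnonpos hm
      nlinarith

/-- **The invariant set fed to the maximum principle**: `{A, C symmetric, M ≥ m}`, `m ≥ 0`, is
forward invariant under Hamilton's ODE. [cite: Hamilton1986, §7, p. 171] -/
theorem isInvariant_isSymm_operatorGE {m : ℝ} (hm : 0 ≤ m) :
    IsInvariant field (fun _ ↦ {p : Blocks | p.1.IsSymm ∧ p.2.2.IsSymm} ∩
      {p : Blocks | OperatorGE p m}) :=
  isInvariant_isSymm.inter_rel_self (isInvariantRel_operatorGE hm)

end Preserved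

end HamiltonODE

/-! ### `M ≥ 0` and `M ≥ m` along the Ricci flow, from the maximum principle for systems -/

open Lorentzian HamiltonODE

universe u

/-- **Hamilton 1986: nonnegative (resp. uniformly positive) curvature operator is preserved by
the Ricci flow on a closed 4-manifold, reduced to the maximum principle for systems** exactly as
in the paper (§4, Thm. 4.3 with §5, 5.2, p. 164: "at time `t = 0` the curvature operator `M` lies
in `X = P ×_G Z`. Then it will remain in `X` by the argument in §4"; §7, p. 171: "Note first that
`M ≥ 0` is preserved"): given the named fact `hamilton_maximumPrinciple_curvatureODE`
(`HamiltonCurvatureODE.lean`), if along a Ricci flow of Riemannian metrics on `[0, T)` on a closed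
smooth 4-manifold the blocks `(A, B, C)` of `g(0)` satisfy `M ≥ m` (`OperatorGE`, `m ≥ 0`) at
every point in every orthonormal frame, then so do the blocks of `g(t)` for all `t ∈ [0, T)`.
The maximum principle is applied to the closed convex `B ↦ -B`-symmetric invariant set
`{A, C symmetric, M ≥ m}` (`isInvariant_isSymm_operatorGE`), which contains the blocks of
`g(0)` (symmetric for a Levi-Civita connection, `blockA_isSymm`, `blockC_isSymm`).
[cite: Hamilton1986, §7, p. 171; §5, 5.2 (p. 164); §4, Thm. 4.3 (p. 162)] -/
theorem ricciFlow_preserves_operatorGE_of_maximumPrinciple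
    (hMP : hamilton_maximumPrinciple_curvatureODE.{u})
    (M : Type u) [TopologicalSpace M] [T2Space M] [SecondCountableTopology M] [CompactSpace M]
    [ChartedSpace (EuclideanSpace ℝ (Fin 4)) M] [IsManifold (𝓡 4) ∞ M] (T : ℝ)
    (g : ℝ → PseudoRiemannianMetric (𝓡 4) ∞ (EuclideanSpace ℝ (Fin 4))
      (TangentSpace (𝓡 4) : M → Type _))
    (cov : ℝ → CovariantDerivative (𝓡 4) (EuclideanSpace ℝ (Fin 4))
      (TangentSpace (𝓡 4) : M → Type _))
    (hflow : IsRicciFlow g cov (Ico 0 T)) (hRiem : ∀ t ∈ Ico 0 T, (g t).IsRiemannian)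
    {m : ℝ} (hm : 0 ≤ m)
    (h0 : ∀ (x : M) (e : Fin 4 → TangentSpace (𝓡 4) x), (g 0).IsOrthonormalFrame x e →
      OperatorGE ((g 0).blockA (cov 0) x e, (g 0).blockB (cov 0) x e, (g 0).blockC (cov 0) x e) m) :
    ∀ t ∈ Ico 0 T, ∀ (x : M) (e : Fin 4 → TangentSpace (𝓡 4) x), (g t).IsOrthonormalFrame x e →
      OperatorGE ((g t).blockA (cov t) x e, (g t).blockB (cov t) x e, (g t).blockC (cov t) x e)
        m := by
  intro t ht x e he
  have hT : 0 < T := ht.1.trans_lt ht.2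
  have hLC : (g 0).IsLeviCivita (cov 0) := hflow.isLeviCivita 0 ⟨le_rfl, hT⟩
  have hn : (2 : ℕ∞ω) ≤ ∞ := WithTop.coe_le_coe.mpr le_top
  have hcl : IsClosed ({p : Blocks | p.1.IsSymm ∧ p.2.2.IsSymm} ∩ {p : Blocks | OperatorGE p m}) :=
    isClosed_isSymm.inter (isClosed_operatorGE m)
  have hZ := hMP M T g cov hflow hRiem
    (fun _ ↦ {p : Blocks | p.1.IsSymm ∧ p.2.2.IsSymm} ∩ {p : Blocks | OperatorGE p m})
    (fun _ ↦ hcl)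
    (fun _ ↦ by
      intro p hp q hq a b ha hb hab
      exact ⟨isSymm_combo hp.1 hq.1 a b, hp.2.combo hq.2 ha hb hab⟩)
    (isClosed_Ici.prod hcl) (fun _ p hp ↦ ⟨⟨hp.1.1, hp.1.2⟩, hp.2.reflectB⟩)
    (isInvariant_isSymm_operatorGE hm)
    (fun x e he ↦ ⟨⟨blockA_isSymm hLC hn x e, blockC_isSymm hLC hn x e⟩, h0 x e he⟩) t ht x e he
  exact hZ.2

end Literature.Geometry.Riemannian

end
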